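import Mathlib
import HarnessLib
import Summits.HubbardSuperconductivity.HubbardSuperconductivity.Theorems.KLProgrammeKLRegimeSplitTwoLegSizesMSChainFrames

/-!
# Route `KLProgramme`, crux K3 — gen-5 ENGINE child (stmt-…-19918, `stub_twoLeg_step`, clause `TwoLegSizesMST`), recipe (L)+(F):
# THE TELESCOPED PROFILES WITH A SYMBOL FAMILY RIDING THE CHAIN (`msProfileF`)

Seat hubbard-kl-k3c3-p1 (g3).  Generalisation of `…MSChainFrames` §3 requested by k3c3-p2 (MS-CONSUMER §2-addendum, STATUS
2026-08-27T05:00:59Z): the increment symbol is not one `S` read at every chain frame but a FAMILY `S : ℕ → TrigPolyC4v`, `S k` = the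
symbol at the chain frame `msChain d Kp n N k` (its moments are then clean to that frame's own depth).  Profiles:
`n ↦ (S 0)∘γ[msChain 0]`, `m ∈ Ioc n N ↦ (S k)∘γ[msChain k] − (S (k−1))∘γ[msChain (k−1)]` (`k = m − n`), else `0`; they telescope to
`(S (N−n))∘γ[K]` (`msProfileF_split`), are `2π`-periodic, even and diagonal-symmetric, and each slot profile is the sum of a RESPONSE term
`(S k − S (k−1))∘γ[msChain k]` and a TRANSPORT term `(S (k−1))∘γ[msChain k] − (S (k−1))∘γ[msChain (k−1)]` (`msProfileF_slot`).
Definitions + identities only; nothing about the model.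
-/

noncomputable section

namespace Summit.HubbardSuperconductivity.HubbardSuperconductivity.Theorems.KLRegimeSplit

set_option linter.dupNamespace false -- summit = problem name (single-conjunct summit), D-0017

open Real Finset Literature.MathematicalPhysics.QuantumLattice

/-- **The profiles of the witness, symbol family riding the chain**: `n ↦ (S 0)∘γ[msChain 0]`,
`m ∈ Ioc n N ↦ (S (m−n))∘γ[msChain (m−n)] − (S (m−n−1))∘γ[msChain (m−n−1)]`, else `0`. -/
def msProfileF (μ : ℝ) (S : ℕ → TrigPolyC4v) (d : ℕ) (Kp : ℕ → TrigPolyC4v) (n N m : ℕ) (θ : ℝ) : ℝ :=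
  if m = n then curveProfile μ (S 0) (msChain d Kp n N 0) θ
  else if m ∈ Ioc n N then
    curveProfile μ (S (m - n)) (msChain d Kp n N (m - n)) θ - curveProfile μ (S (m - n - 1)) (msChain d Kp n N (m - n - 1)) θ
  else 0

/-- **TELESCOPING**: `(S (N−n))∘γ[K] = msProfileF n + Σ_{m ∈ Ioc n N} msProfileF m`. -/
theorem msProfileF_split (μ : ℝ) (S : ℕ → TrigPolyC4v) (d : ℕ) {K : TrigPolyC4v} {Kp : ℕ → TrigPolyC4v} {N : ℕ}
    (hK : ∀ p : Fin 2 → ℝ, K.eval p = ∑ m ∈ range (N + 1), (Kp m).eval p) {n : ℕ} (hnN : n ≤ N) (θ : ℝ) :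
    curveProfile μ (S (N - n)) K θ = msProfileF μ S d Kp n N n θ + ∑ m ∈ Ioc n N, msProfileF μ S d Kp n N m θ := by
  set g : ℕ → ℝ := fun k => curveProfile μ (S k) (msChain d Kp n N k) θ with hg
  have hsum : ∑ m ∈ Ioc n N, msProfileF μ S d Kp n N m θ = ∑ i ∈ range (N - n), (g (i + 1) - g i) := by
    rw [(show Ioc n N = Ico (n + 1) (N + 1) by ext m; simp only [Finset.mem_Ioc, Finset.mem_Ico]; omega),
      Finset.sum_Ico_eq_sum_range, show N + 1 - (n + 1) = N - n by omega]
    refine Finset.sum_congr rfl fun i hi => ?_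
    have hne : n + 1 + i ≠ n := by omega
    have hmem : n + 1 + i ∈ Ioc n N := by have := mem_range.mp hi; rw [Finset.mem_Ioc]; omega
    simp only [msProfileF, if_neg hne, if_pos hmem, hg]
    rw [show n + 1 + i - n = i + 1 by omega, show i + 1 - 1 = i by omega]
  rw [hsum, Finset.sum_range_sub, hg]
  simp only [msProfileF, if_true, curveProfile]
  rw [klFermiPoint_msChain_last d hK hnN μ]
  ring

/-- The base profile. -/
theorem msProfileF_base (μ : ℝ) (S : ℕ → TrigPolyC4v) (d : ℕ) (Kp : ℕ → TrigPolyC4v) (n N : ℕ) :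
    msProfileF μ S d Kp n N n = curveProfile μ (S 0) (msChain d Kp n N 0) := by
  funext θ; simp [msProfileF]

/-- **A slot profile = RESPONSE + TRANSPORT**: for `m ∈ Ioc n N`, `k = m − n`,
`msProfileF m = (S k − S (k−1))∘γ[msChain k] + ((S (k−1))∘γ[msChain k] − (S (k−1))∘γ[msChain (k−1)])`. -/
theorem msProfileF_slot (μ : ℝ) (S : ℕ → TrigPolyC4v) (d : ℕ) (Kp : ℕ → TrigPolyC4v) {n N m : ℕ} (hm : m ∈ Ioc n N) (θ : ℝ) :
    msProfileF μ S d Kp n N m θ =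
      curveProfile μ (fsub (S (m - n)) (S (m - n - 1))) (msChain d Kp n N (m - n)) θ +
        (curveProfile μ (S (m - n - 1)) (msChain d Kp n N (m - n)) θ -
          curveProfile μ (S (m - n - 1)) (msChain d Kp n N (m - n - 1)) θ) := by
  have hne : m ≠ n := by have := (Finset.mem_Ioc.mp hm).1; omega
  simp only [msProfileF, if_neg hne, if_pos hm, curveProfile, eval_fsub]
  ring

/-- The profiles are `2π`-periodic. -/
theorem msProfileF_periodic (μ : ℝ) (S : ℕ → TrigPolyC4v) (d : ℕ) (Kp : ℕ → TrigPolyC4v) (n N m : ℕ) :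
    Function.Periodic (msProfileF μ S d Kp n N m) (2 * π) := by
  intro θ
  simp only [msProfileF, curveProfile, klFermiPoint_periodic μ _ θ]

/-- The profiles are even. -/
theorem msProfileF_even (μ : ℝ) (S : ℕ → TrigPolyC4v) (d : ℕ) (Kp : ℕ → TrigPolyC4v) (n N m : ℕ) (θ : ℝ) :
    msProfileF μ S d Kp n N m (-θ) = msProfileF μ S d Kp n N m θ := by
  simp only [msProfileF, curveProfile, klFermiPoint_neg, TrigPolyC4v.eval_reflect]

/-- The profiles are `θ ↦ π/2 − θ` symmetric. -/
theorem msProfileF_diag (μ : ℝ) (S : ℕ → TrigPolyC4v) (d : ℕ) (Kp : ℕ → TrigPolyC4v) (n N m : ℕ) (θ : ℝ) :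
    msProfileF μ S d Kp n N m (π / 2 - θ) = msProfileF μ S d Kp n N m θ := by
  simp only [msProfileF, curveProfile, klFermiPoint_pi_div_two_sub, TrigPolyC4v.eval_swap]

/-- The profiles vanish off `{n} ∪ Ioc n N`. -/
theorem msProfileF_of_not_mem {μ : ℝ} {S : ℕ → TrigPolyC4v} {d : ℕ} {Kp : ℕ → TrigPolyC4v} {n N m : ℕ} (hm : m ≠ n)
    (hm' : m ∉ Ioc n N) : msProfileF μ S d Kp n N m = fun _ => 0 := by
  funext θ; simp [msProfileF, hm, hm']

/-- A constant family gives back `msProfile`. -/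
theorem msProfileF_const (μ : ℝ) (S : TrigPolyC4v) (d : ℕ) (Kp : ℕ → TrigPolyC4v) (n N m : ℕ) :
    msProfileF μ (fun _ => S) d Kp n N m = msProfile μ S d Kp n N m := by
  funext θ; simp only [msProfileF, msProfile]

end Summit.HubbardSuperconductivity.HubbardSuperconductivity.Theorems.KLRegimeSplit

end
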